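/-
COR-CM (cell pub-hodgecm2, stage 2 of the Hodge ladder) — count-neutral KERNEL COMBINATORICS «the sheared dihedral family», part X: the potential and the
reducing faces are `s`-stable (seat prover-pub-hodgecm2-b23-g52-0, binder prover b23, gen 52; claim «SYLOW TRANSFER XII + THE SHEARED DIHEDRAL FAMILY»,
HOME/INBOX.md l.23708).  Theorems only, on part VI (`Census/ShearedDihedralEquivariance.lean`) and gen 44ʼs `Census/QuarticInversion{Potential,Descent}.lean`
(`pot₄`, `corner`, `clsTy`, `half`) BY NAME; no `decide` beyond literals of `Fin 3`/`Fin 4`, no certificate, no named fact, no `sorry`.  `Interfaces.lean`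
(C1), every E term, B01, `Transposition/*`, `PortJoin/*`, `D2Bridge/*` untouched.
HONEST FRAMING: `HC_CM` is NOT proved, here or anywhere in the tree; nothing here is a period, a count of record or a headline.
-/
import Summits.HodgeConjecture.CorCM.Census.ShearedDihedralEquivariance
import Summits.HodgeConjecture.CorCM.Census.QuarticInversionDescent

/-!
# The sheared dihedral family, X: gen 44ʼs potential and reducing faces under the motion of `s`

Word for word gen 44ʼs part VI for `t`, with `twS` for `twT` (the motion of `s` permutes the four coordinates by `σT` and conjugates two of them,
and a conjugated slice label has the same class `clsTy`):
* **`pot₄_twS : pot₄ (twS Θ) = pot₄ Θ`** — the potential is `s`-invariant;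
* `corner_twS` — the corners of an `s`-moved face are the `s`-moved corners; `half_coord_twS_eq_iff`;
* **`reducing_twS`** — a REDUCING pair of places at `Θ` (all three flipped corners of smaller potential, every half preserved) moves to a reducing pair
  at `twS Θ`; so with gen 44ʼs `reducing_twH₄`/`reducing_twY` ONE reducing face per non-residual block of the X_n label model covers every
  non-residual label (numerics at `B = ℤ/3`: 182 such blocks, `HOME/pub-hodgecm2-b23/SHEARED-DIHEDRAL.md` §3b).
All [folklore].

## References
* [Pohlmann1968] H. Pohlmann, Algebraic cycles on abelian varieties of complex multiplication type, Ann. of Math. 88 (1968), Thm 1.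
-/

namespace Summit.HodgeConjecture.CorCM.Census.ShearedDihedral

open Finset
open Summit.HodgeConjecture.CorCM.Census.OddSliceFacesModel
open Summit.HodgeConjecture.CorCM.Census.OddSliceFacesSquares (clsTy)
open Summit.HodgeConjecture.CorCM.Census.EvenSliceFacesDescent (clsTy_add_one)
open Summit.HodgeConjecture.CorCM.Census.QuarticInversion

noncomputable section

variable (A : Type) [AddCommGroup A] [Fintype A] [DecidableEq A]

omit [DecidableEq A] in
/-- **The potential is invariant under the motion of `s`.** [folklore] -/
theorem pot₄_twS (Θ : Ty₄ A) : pot₄ A (twS A Θ) = pot₄ A Θ := by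
  obtain ⟨⟨ψ₀, ψ₁⟩, ⟨ψ₂, ψ₃⟩⟩ := Θ
  show clsTy A ψ₂ + clsTy A (ψ₃ + 1) + clsTy A ψ₀ + clsTy A (ψ₁ + 1) = clsTy A ψ₀ + clsTy A ψ₁ + clsTy A ψ₂ + clsTy A ψ₃
  rw [clsTy_add_one, clsTy_add_one]
  ring

omit [AddCommGroup A] [Fintype A] in
/-- The corners of an `s`-moved face are the `s`-moved corners. [folklore] -/
theorem corner_twS (Θ : Ty₄ A) (p q : Pl A) (c : Fin 3) :
    corner A (twS A Θ) (plT A p) (plT A q) c = twS A (corner A Θ p q c) := by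
  fin_cases c <;> simp [corner, twS_flipAt]

omit [AddCommGroup A] [DecidableEq A] in
/-- Equal halves coordinatewise are preserved by the motion of `s` (`|B|` odd). [folklore] -/
theorem half_coord_twS_eq_iff (hA : Odd (Fintype.card A)) (Θ Θ' : Ty₄ A) (n : Fin 4) :
    half A (coord A n (twS A Θ)) = half A (coord A n (twS A Θ')) ↔ half A (coord A (σT n) Θ) = half A (coord A (σT n) Θ') := by
  rw [half_coord_twS A hA, half_coord_twS A hA]
  cases half A (coord A (σT n) Θ) <;> cases half A (coord A (σT n) Θ') <;> cases bS n <;> decide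

/-- **Reducing pairs move with the labels (`s`).** [folklore] -/
theorem reducing_twS (hA : Odd (Fintype.card A)) {Θ : Ty₄ A} {p q : Pl A}
    (h : p ≠ q ∧ ∀ c, pot₄ A (corner A Θ p q c) < pot₄ A Θ ∧ ∀ n, half A (coord A n (corner A Θ p q c)) = half A (coord A n Θ)) :
    plT A p ≠ plT A q ∧ ∀ c, pot₄ A (corner A (twS A Θ) (plT A p) (plT A q) c) < pot₄ A (twS A Θ) ∧
      ∀ n, half A (coord A n (corner A (twS A Θ) (plT A p) (plT A q) c)) = half A (coord A n (twS A Θ)) := by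
  refine ⟨fun e => h.1 (plT_injective A e), fun c => ⟨?_, fun n => ?_⟩⟩
  · rw [corner_twS, pot₄_twS, pot₄_twS]; exact (h.2 c).1
  · rw [corner_twS, half_coord_twS_eq_iff A hA]; exact (h.2 c).2 _

end

end Summit.HodgeConjecture.CorCM.Census.ShearedDihedral
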